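import Summits.KontsevichZagierPeriods.KontsevichZagierPeriods.Theorems.HurwitzMicroSectorsNormalFormPrincipleM3EbdDualityAndSplits

/-!
# `NormalFormPrinciple` (stmt-KontsevichZagierPeriods-3869), line `SketchIdeator1` —
# leaf `stub_boxRigidity`, layer L2W3 (level-2 weight-3 descent): the reflection move

Pure proof file (registered sub-goal `l2w3_reflection_move` of the layer `L2W3`, lead seat c9;
`--supports` the crux). On the decreasing open simplex `Δ = {0 < t₂ < t₁ < t₀ < 1} ⊆ ℝ³` a *word
representation* is `[Δ, x(t₀) y(t₁) z(t₂)]` for letters `x, y, z : ℝ → ℝ` (the iterated integral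
`∫ x y z` over `1 > t₀ > t₁ > t₂ > 0`). The REFLECTION `t ↦ 1 − t` on all three coordinates with
order reversal, i.e. the affine involution `ι(t) = (1 − t₂, 1 − t₁, 1 − t₀)` of `Δ` (the landed
chart `ebd3_exists_dualityChart`: a `ℚ`-polynomial map with constant derivative of determinant `1`,
`ι ∘ ι = id`, so `ι` is injective on `Δ` and `ι '' Δ = Δ`), carries the word `x y z` to the word
`z̄ ȳ x̄` with `f̄(u) = f(1 − u)` (it exchanges the letters `1/u ↔ 1/(1 − u)` and
`1/(1 + u) ↔ 1/(2 − u)`; it is MZV duality `ζ(2,1) = ζ(3)`). This file proves, for an ARBITRARY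
word integrand of a GIVEN representation `T` on `Δ`:

1. `[N] − [T] ∈ KZ.relations` for every representation `N` on `Δ` whose integrand agrees with
   `z(1 − t₀) y(1 − t₁) x(1 − t₂)` on `Δ`, as ONE change of variables (rule (2),
   `KZ.changeOfVariablesRel`) along `ι`: the pull-back identity
   `N.integrand t = T.integrand (ι t) · |det Dι|` on `Δ` reads
   `z(1 − t₀) y(1 − t₁) x(1 − t₂) = x(1 − t₂) y(1 − t₁) z(1 − t₀) · 1` (`l2r_reflection_rel`);
2. the EXISTENCE of such an `N` (`l2r_exists_reflected`): its integrand is `ℚ`-semialgebraic on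
   `Δ` as the composite of `T.integrand` with the `ℚ`-semialgebraic chart `ι : Δ → Δ`
   (`IsSemialgebraicFunOn.comp_isSemialgebraicMapOn_holds`, then congruence on `Δ`), and
   absolutely integrable on `Δ` by the Jacobian-`1` change of variables
   (`MeasureTheory.integrableOn_image_iff_integrableOn_abs_det_fderiv_smul` with `ι '' Δ = Δ`).

Nothing about `x, y, z` is assumed beyond what `T` provides.

References: M. Kontsevich, D. Zagier, *Periods* (2001), §1.1–1.2, rule (2). No definitions are
introduced.
-/

noncomputable section

open MeasureTheory Set
open Literature.NumberTheory.Transcendental Literature.NumberTheory.Transcendental.KZ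
open Literature.ModelTheory.ExponentialFields (IsSemialgebraic)

namespace Summit.KontsevichZagierPeriods.HurwitzMicroSectors.NormalFormPrinciple.PiBox.M3

/-! ## The reflection preserves the decreasing open simplex -/

/-- A map with components `(1 − t₂, 1 − t₁, 1 − t₀)` sends the decreasing open simplex
`Δ = {0 < t₂ < t₁ < t₀ < 1}` into itself. [folklore] -/
theorem l2r_mapsTo_simplex {Φ : (Fin 3 → ℝ) → (Fin 3 → ℝ)}
    (hΦ0 : ∀ t, Φ t 0 = 1 - t 2) (hΦ1 : ∀ t, Φ t 1 = 1 - t 1) (hΦ2 : ∀ t, Φ t 2 = 1 - t 0)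
    {D : Set (Fin 3 → ℝ)} (hD : D = {t | 0 < t 2 ∧ t 2 < t 1 ∧ t 1 < t 0 ∧ t 0 < 1}) :
    MapsTo Φ D D := by
  intro t ht
  rw [hD] at ht ⊢
  obtain ⟨h2, h21, h10, h01⟩ := ht
  simp only [mem_setOf_eq, hΦ0, hΦ1, hΦ2]
  exact ⟨by linarith, by linarith, by linarith, by linarith⟩

/-- An involution mapping a set `D` into itself maps `D` onto itself and is injective on `D`.
[folklore] -/
theorem l2r_image_eq_and_injOn {Φ : (Fin 3 → ℝ) → (Fin 3 → ℝ)} (hinv : ∀ t, Φ (Φ t) = t)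
    {D : Set (Fin 3 → ℝ)} (hmaps : MapsTo Φ D D) : Φ '' D = D ∧ InjOn Φ D := by
  refine ⟨Subset.antisymm ?_ fun w hw => ⟨Φ w, hmaps hw, hinv w⟩, fun u _ v _ huv =>
    (hinv u).symm.trans (by rw [huv]; exact hinv v)⟩
  rintro _ ⟨t, ht, rfl⟩
  exact hmaps ht

/-! ## Part 1: the reflection as ONE rule-(2) move -/

/-- **The reflection move on word integrands.** Let `T` be a representation on the decreasing open
simplex `Δ` whose integrand agrees with the word `x(t₀) y(t₁) z(t₂)` on `Δ`, and let `N` be any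
representation on `Δ` whose integrand agrees with the reflected word `z(1 − t₀) y(1 − t₁) x(1 − t₂)`
on `Δ`. Then `[N] − [T]` is ONE change-of-variables move of the Kontsevich–Zagier calculus along
the affine involution `ι(t) = (1 − t₂, 1 − t₁, 1 − t₀)` of `Δ` (`ebd3_exists_dualityChart`,
`|det Dι| = 1`): the pull-back identity `N.integrand t = T.integrand (ι t) · |det Dι|` on `Δ` is
`z(1 − t₀) y(1 − t₁) x(1 − t₂) = x(1 − t₂) y(1 − t₁) z(1 − t₀) · 1`.
[cite: KontsevichZagier2001, §1.2 rule (2)] -/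
theorem l2r_reflection_rel (x y z : ℝ → ℝ) (T : IntegralRep 3)
    (hTd : T.domain = {t | 0 < t 2 ∧ t 2 < t 1 ∧ t 1 < t 0 ∧ t 0 < 1})
    (hTi : EqOn T.integrand (fun t => x (t 0) * y (t 1) * z (t 2)) T.domain)
    (N : IntegralRep 3) (hNd : N.domain = {t | 0 < t 2 ∧ t 2 < t 1 ∧ t 1 < t 0 ∧ t 0 < 1})
    (hNi : EqOn N.integrand (fun t => z (1 - t 0) * y (1 - t 1) * x (1 - t 2)) N.domain) :
    of N - of T ∈ relations := by
  obtain ⟨Φ, Φ', hΦ0, hΦ1, hΦ2, hsa, hderiv, hinv, hdet⟩ := ebd3_exists_dualityChart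
  -- `ι` maps `Δ` into `Δ`, hence (being an involution) onto `Δ`, injectively
  have hmaps : MapsTo Φ N.domain N.domain := l2r_mapsTo_simplex hΦ0 hΦ1 hΦ2 hNd
  obtain ⟨hfix, hinj⟩ := l2r_image_eq_and_injOn hinv hmaps
  have himage : T.domain = Φ '' N.domain := by rw [hfix, hTd, hNd]
  refine changeOfVariablesRel_subset_relations
    ⟨3, N, T, Φ, Φ', hsa _ N.isSemialgebraic_domain, fun t _ => (hderiv t).hasFDerivWithinAt,
      hinj, himage, fun t ht => ?_, rfl⟩
  -- the pull-back identity on `Δ`, Jacobian `|det Dι| = 1` included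
  have hΦt : Φ t ∈ T.domain := himage ▸ mem_image_of_mem _ ht
  rw [hNi ht, hTi hΦt, hdet t, abs_one, mul_one]
  simp only [hΦ0, hΦ1, hΦ2]
  ring

/-! ## Part 2: the reflected word carrier exists -/

/-- **The reflected word representation exists.** Let `T` be a representation on the decreasing
open simplex `Δ` whose integrand agrees with the word `x(t₀) y(t₁) z(t₂)` on `Δ`. Then
`[Δ, z(1 − t₀) y(1 − t₁) x(1 − t₂)]` is an integral representation of the Kontsevich–Zagier
calculus: on `Δ` its integrand is `T.integrand ∘ ι` for the affine involution
`ι(t) = (1 − t₂, 1 − t₁, 1 − t₀)` of `Δ` (`ebd3_exists_dualityChart`), hence `ℚ`-semialgebraic on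
`Δ` (composite of a semialgebraic function with a semialgebraic map, Tarski–Seidenberg), and it is
absolutely integrable on `Δ = ι '' Δ` by the change-of-variables formula with Jacobian
`|det Dι| = 1`. [cite: KontsevichZagier2001, §1.1–1.2 rule (2)] -/
theorem l2r_exists_reflected (x y z : ℝ → ℝ) (T : IntegralRep 3)
    (hTd : T.domain = {t | 0 < t 2 ∧ t 2 < t 1 ∧ t 1 < t 0 ∧ t 0 < 1})
    (hTi : EqOn T.integrand (fun t => x (t 0) * y (t 1) * z (t 2)) T.domain) :
    ∃ N : IntegralRep 3, N.domain = {t | 0 < t 2 ∧ t 2 < t 1 ∧ t 1 < t 0 ∧ t 0 < 1} ∧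
      N.integrand = fun t => z (1 - t 0) * y (1 - t 1) * x (1 - t 2) := by
  obtain ⟨Φ, Φ', hΦ0, hΦ1, hΦ2, hsa, hderiv, hinv, hdet⟩ := ebd3_exists_dualityChart
  have hmaps : MapsTo Φ T.domain T.domain := l2r_mapsTo_simplex hΦ0 hΦ1 hΦ2 hTd
  obtain ⟨hfix, hinj⟩ := l2r_image_eq_and_injOn hinv hmaps
  -- on `Δ`, `T.integrand ∘ ι` is the reflected word
  have hpt : ∀ t ∈ T.domain, T.integrand (Φ t) = z (1 - t 0) * y (1 - t 1) * x (1 - t 2) := by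
    intro t ht
    rw [hTi (hmaps ht)]
    simp only [hΦ0, hΦ1, hΦ2]
    ring
  -- semialgebraicity by composition with the chart
  have hsa' : IsSemialgebraicFunOn ℚ T.domain
      (fun t => z (1 - t 0) * y (1 - t 1) * x (1 - t 2)) :=
    (IsSemialgebraicFunOn.comp_isSemialgebraicMapOn_holds T.isSemialgebraicFunOn_integrand
      (hsa _ T.isSemialgebraic_domain) hmaps).congr fun t ht => hpt t ht
  -- integrability transported along the Jacobian-`1` chart `ι : Δ → Δ = ι '' Δ`
  have hDm : MeasurableSet T.domain := IntegralRep.measurableSet_domain_holds T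
  have hint : IntegrableOn (fun t => z (1 - t 0) * y (1 - t 1) * x (1 - t 2)) T.domain := by
    have h0 : IntegrableOn T.integrand (Φ '' T.domain) := by rw [hfix]; exact T.integrableOn
    have h := (integrableOn_image_iff_integrableOn_abs_det_fderiv_smul volume hDm
      (fun t _ => (hderiv t).hasFDerivWithinAt) hinj T.integrand).mp h0
    refine h.congr_fun (fun t ht => ?_) hDm
    show |(Φ' t).det| • T.integrand (Φ t) = z (1 - t 0) * y (1 - t 1) * x (1 - t 2)
    rw [hdet t, abs_one, one_smul, hpt t ht]
  exact ⟨⟨T.domain, _, T.isSemialgebraic_domain, hsa', hint⟩, hTd, rfl⟩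

/-! ## The registered sub-goal -/

/-- **Stub L4 (`l2w3_reflection_move`; registered sub-goal of stmt-KontsevichZagierPeriods-3869,
line `SketchIdeator1`, layer `L2W3`).** On the decreasing open simplex
`Δ = {0 < t₂ < t₁ < t₀ < 1} ⊆ ℝ³`, for arbitrary letters `x, y, z : ℝ → ℝ` and a given
representation `T = [Δ, x(t₀) y(t₁) z(t₂)]` (integrand up to agreement on `Δ`): (1) every
representation `N = [Δ, z(1 − t₀) y(1 − t₁) x(1 − t₂)]` (integrand up to agreement on `Δ`)
satisfies `[N] − [T] ∈ KZ.relations`, by ONE change of variables along the reflection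
`t ↦ (1 − t₂, 1 − t₁, 1 − t₀)` of `Δ` onto itself, `|det| = 1` (`l2r_reflection_rel`); (2) such an
`N` exists (`l2r_exists_reflected`). [cite: KontsevichZagier2001, §1.2 rule (2)] -/
theorem l2w3_reflection_move :
    ∀ (x y z : ℝ → ℝ) (T : IntegralRep 3),
      T.domain = {t | 0 < t 2 ∧ t 2 < t 1 ∧ t 1 < t 0 ∧ t 0 < 1} →
      EqOn T.integrand (fun t => x (t 0) * y (t 1) * z (t 2)) T.domain →
      (∀ N : IntegralRep 3, N.domain = {t | 0 < t 2 ∧ t 2 < t 1 ∧ t 1 < t 0 ∧ t 0 < 1} →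
        EqOn N.integrand (fun t => z (1 - t 0) * y (1 - t 1) * x (1 - t 2)) N.domain →
        of N - of T ∈ relations) ∧
      (∃ N : IntegralRep 3, N.domain = {t | 0 < t 2 ∧ t 2 < t 1 ∧ t 1 < t 0 ∧ t 0 < 1} ∧
        N.integrand = fun t => z (1 - t 0) * y (1 - t 1) * x (1 - t 2)) := by
  intro x y z T hTd hTi
  exact ⟨l2r_reflection_rel x y z T hTd hTi, l2r_exists_reflected x y z T hTd hTi⟩

end Summit.KontsevichZagierPeriods.HurwitzMicroSectors.NormalFormPrinciple.PiBox.M3
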